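import Summits.ValiantsHypothesis.ValiantsHypothesis.Theorems.KPlusLogSqLawTropicalBMarkedEdgeCoreQTrunk

/-!
# Route «KPlusLogSqLaw», crux `TropicalB` (stmt-ValiantsHypothesis-19771) — MARKED-EDGE sector, NESTED-TRIANGLE CORE, ALL sizes:
# the Q-COVER THEOREM (g18's «S3*»), part C1 — two pairs sharing a colour cannot be in the same class

HONEST FRAMING.  Helper file (cell `pub-symmetroid`, seat val-sym-trop-p4 (g19), 2026-08-29; `--supports stmt-ValiantsHypothesis-19771 --as
helper`).  Continues part A (`…CoreQTrunk`).  Pure permutation combinatorics.  Nothing here proves the law; nothing concerns `TropicalB` in its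
window, `WeakLifting`, the doors, `MatrixDescartes` (stmt-ValiantsHypothesis-18050) or VP ≠ VNP.

SETTING.  Two pairs of colours SHARING the colour `σ`: pair j = `(σ, μ)` with marked arc `b ↦ z` (`σ b = μ b = z`, and the third colour
`τ` does NOT continue it: `τ b ≠ z`), pair k = `(σ, τ)` with marked arc `c ↦ w` (`σ c = τ c = w`, `μ c ≠ w`); gate `s` (= b4).  By the trunk
dichotomy of part A (forwards or backwards) each failing pair carries one of four labels: TRUNK `T` (forward common orbit of `s` up to the
arc), CO-TRUNK `coT` (an A1-witness containing the other pairs' marked tails), backward TRUNK `T'`, backward CO-TRUNK `coT'` (an A2-witness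
containing the other pairs' marked heads).  CLASS X = `T ∨ coT'`, CLASS Y = `coT ∨ T'`.

CONTENTS.  `classX_pair_false`, `classY_pair_false`: two pairs sharing a colour are never both in class X, nor both in class Y (the four
sub-cases each are one of part A's `two_trunks_false` / `two_cotrunks_false` / `cotrunk_trunk_false`, read on the forward or on the backward
`σ`-orbit of the gate).  With three pairs (pairwise sharing a colour) and two classes this is the pigeonhole that proves S3\* (part C2).
-/

set_option linter.dupNamespace false
set_option autoImplicit false

namespace Summit.ValiantsHypothesis.ValiantsHypothesis.Theorems.KPlusLogSqLaw
namespace MarkedEdge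
namespace Core
namespace QCover

open Finset

variable {V : Type*} [Fintype V] [DecidableEq V]

/-- **Class X twice is impossible.**  Pairs `(σ,μ)` at `b ↦ z` and `(σ,τ)` at `c ↦ w` sharing `σ`: labels «forward trunk» or «backward
co-trunk (A2-witness `B ∋ w` resp. `E ∋ z`, succ-closed for `σ` up to `s`)» for both pairs contradict `τ b ≠ z`, `μ c ≠ w`.
[this seat's lemma] -/
theorem classX_pair_false (σ μ τ : Equiv.Perm V) (s b z c w : V)
    (hσb : σ b = z) (hτb : τ b ≠ z) (hσc : σ c = w) (hμc : μ c ≠ w)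
    (hbc : b ≠ c) (hzw : z ≠ w) (hbs : b ≠ s) (hcs : c ≠ s)
    (Lj : (∃ n, (∀ i, i ≤ n + 1 → (σ ^ i) s = (μ ^ i) s) ∧ (σ ^ n) s = b ∧ (σ ^ (n + 1)) s = z) ∨
      (∃ B : Finset V, z ∈ B ∧ b ∉ B ∧ s ∉ B ∧ (∀ u ∈ B, σ u ∈ B ∨ σ u = s) ∧ w ∈ B))
    (Lk : (∃ n, (∀ i, i ≤ n + 1 → (σ ^ i) s = (τ ^ i) s) ∧ (σ ^ n) s = c ∧ (σ ^ (n + 1)) s = w) ∨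
      (∃ E : Finset V, w ∈ E ∧ c ∉ E ∧ s ∉ E ∧ (∀ u ∈ E, σ u ∈ E ∨ σ u = s) ∧ z ∈ E)) : False := by
  -- backward co-trunk data, read on the FORWARD `σ`-orbit of `s` (A2-witness = A1-witness of `σ⁻¹` with the arc reversed)
  have dual : ∀ (B : Finset V) (b z w : V), σ b = z → z ≠ w → z ∈ B → b ∉ B → s ∉ B → b ≠ s →
      (∀ u ∈ B, σ u ∈ B ∨ σ u = s) → w ∈ B →
      σ⁻¹ w ∈ B ∧ ∃ q, 1 ≤ q ∧ (σ ^ q) s = b ∧ (σ ^ (q + 1)) s = z ∧ ∀ i, 1 ≤ i → i ≤ q → (σ ^ i) s ∉ B := by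
    intro B b z w hσb hzw hz hb hs hbs hcl hw
    have hσ' : σ⁻¹ z = b := by rw [Equiv.Perm.inv_eq_iff_eq, hσb]
    have hpred : ∀ u, σ⁻¹ u ∈ B → u ∈ B ∨ u = s := by
      intro u hu
      rcases hcl _ hu with h | h
      · left; simpa using h
      · right; simpa using h
    refine ⟨witness_step σ⁻¹ B s z b hz hb hs hσ' hpred w (Finset.mem_insert_of_mem hw) hzw.symm, ?_⟩
    obtain ⟨q, hq, h1, h2, h3⟩ := witness_positions σ⁻¹ B s z b hz hb hs hbs hσ' hpred
    rw [inv_inv] at h1 h2 h3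
    exact ⟨q, hq, h1, h2, h3⟩
  rcases Lj with ⟨n, hT, hnb, hnz⟩ | ⟨B, hzB, hbB, hsB, hclB, hwB⟩ <;>
    rcases Lk with ⟨m, hT', hmc, hmw⟩ | ⟨E, hwE, hcE, hsE, hclE, hzE⟩
  · exact two_trunks_false σ μ τ s b z c w n m hT hnb hnz hT' hmc hmw hτb hμc hbc
  · obtain ⟨hbE, q, hq, h1, h2, h3⟩ := dual E c w z hσc hzw.symm hwE hcE hsE hcs hclE hzE
    have e : σ⁻¹ z = b := by rw [Equiv.Perm.inv_eq_iff_eq, hσb]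
    rw [e] at hbE
    exact cotrunk_trunk_false σ μ s E w c b q n h1 h2 h3 hsE hbE hT hnb hμc
  · obtain ⟨hcB, q, hq, h1, h2, h3⟩ := dual B b z w hσb hzw hzB hbB hsB hbs hclB hwB
    have e : σ⁻¹ w = c := by rw [Equiv.Perm.inv_eq_iff_eq, hσc]
    rw [e] at hcB
    exact cotrunk_trunk_false σ τ s B z b c q m h1 h2 h3 hsB hcB hT' hmc hτb
  · obtain ⟨-, q, hq, h1, h2, h3⟩ := dual B b z w hσb hzw hzB hbB hsB hbs hclB hwB
    obtain ⟨-, r, hr, h1', h2', h3'⟩ := dual E c w z hσc hzw.symm hwE hcE hsE hcs hclE hzE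
    exact two_cotrunks_false σ s B E z w (q + 1) (r + 1) (by omega) (by omega) h2
      (fun i hi hi' => h3 i hi (by omega)) h2' (fun i hi hi' => h3' i hi (by omega)) hwB hzE hzw

/-- **Class Y twice is impossible.**  Labels «forward co-trunk (A1-witness `F ∋ c` resp. `G ∋ b`, pred-closed for `σ` up to `s`)» or
«backward trunk» for both pairs contradict `τ b ≠ z`, `μ c ≠ w`. [this seat's lemma] -/
theorem classY_pair_false (σ μ τ : Equiv.Perm V) (s b z c w : V)
    (hσb : σ b = z) (hτb : τ b ≠ z) (hσc : σ c = w) (hμc : μ c ≠ w)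
    (hbc : b ≠ c) (hzw : z ≠ w) (hzs : z ≠ s) (hws : w ≠ s)
    (Lj : (∃ F : Finset V, b ∈ F ∧ z ∉ F ∧ s ∉ F ∧ (∀ u, σ u ∈ F → u ∈ F ∨ u = s) ∧ c ∈ F) ∨
      (∃ n, (∀ i, i ≤ n + 1 → (σ⁻¹ ^ i) s = (μ⁻¹ ^ i) s) ∧ (σ⁻¹ ^ n) s = z ∧ (σ⁻¹ ^ (n + 1)) s = b))
    (Lk : (∃ G : Finset V, c ∈ G ∧ w ∉ G ∧ s ∉ G ∧ (∀ u, σ u ∈ G → u ∈ G ∨ u = s) ∧ b ∈ G) ∨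
      (∃ n, (∀ i, i ≤ n + 1 → (σ⁻¹ ^ i) s = (τ⁻¹ ^ i) s) ∧ (σ⁻¹ ^ n) s = w ∧ (σ⁻¹ ^ (n + 1)) s = c)) : False := by
  have hτ' : τ⁻¹ z ≠ b := fun h => hτb (by rw [Equiv.Perm.inv_eq_iff_eq] at h; exact h.symm)
  have hμ' : μ⁻¹ w ≠ c := fun h => hμc (by rw [Equiv.Perm.inv_eq_iff_eq] at h; exact h.symm)
  rcases Lj with ⟨F, hbF, hzF, hsF, hclF, hcF⟩ | ⟨n, hT, hnz, hnb⟩ <;>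
    rcases Lk with ⟨G, hcG, hwG, hsG, hclG, hbG⟩ | ⟨m, hT', hmw, hmc⟩
  · obtain ⟨q, hq, h1, h2, h3⟩ := witness_positions σ F s b z hbF hzF hsF hzs hσb hclF
    obtain ⟨r, hr, h1', h2', h3'⟩ := witness_positions σ G s c w hcG hwG hsG hws hσc hclG
    exact two_cotrunks_false σ⁻¹ s F G b c (q + 1) (r + 1) (by omega) (by omega) h2
      (fun i hi hi' => h3 i hi (by omega)) h2' (fun i hi hi' => h3' i hi (by omega)) hcF hbG hbc
  · obtain ⟨q, hq, h1, h2, h3⟩ := witness_positions σ F s b z hbF hzF hsF hzs hσb hclF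
    have hwF : w ∈ F := by
      rw [← hσc]; exact witness_step σ F s b z hbF hzF hsF hσb hclF c (Finset.mem_insert_of_mem hcF) hbc.symm
    exact cotrunk_trunk_false σ⁻¹ τ⁻¹ s F b z w q m h1 h2 h3 hsF hwF hT' hmw hτ'
  · obtain ⟨r, hr, h1', h2', h3'⟩ := witness_positions σ G s c w hcG hwG hsG hws hσc hclG
    have hzG : z ∈ G := by
      rw [← hσb]; exact witness_step σ G s c w hcG hwG hsG hσc hclG b (Finset.mem_insert_of_mem hbG) hbc
    exact cotrunk_trunk_false σ⁻¹ μ⁻¹ s G c w z r n h1' h2' h3' hsG hzG hT hnz hμ'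
  · exact two_trunks_false σ⁻¹ μ⁻¹ τ⁻¹ s z b w c n m hT hnz hnb hT' hmw hmc hτ' hμ' hzw

end QCover
end Core
end MarkedEdge
end Summit.ValiantsHypothesis.ValiantsHypothesis.Theorems.KPlusLogSqLaw
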